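import Literature.AlgebraicGeometry.ShimuraVarieties.UnitaryCurveSiegelDescent
import HarnessLib

/-!
# The slice-field descent of the curve-to-Siegel morphism SEPARATES complex points when its point map is injective
# ([Milne 2005] Thm. 13.7 ∕ Rem. 13.8 with Thm. 5.17; [RSZ 2020] (3.10))

Topic `AlgebraicGeometry/ShimuraVarieties`, namespace `…ShimuraVarieties.UnitaryCanonicalModel`.  THEOREMS ONLY (no definition, no instance, no
notation, no named fact, no `sorry`).  Sequel of ★ `UnitaryCurveSiegelDescent` (E5 organ of the P6 E-line of crux hLiu418, cell `hodgecm-mathlib`):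
there `RecordSystemGS.exists_sliceDescent_of_complex` produces an `E`-morphism `ε : M_K ⊗_L E → M ⊗_ℚ E` «inducing `f`» — for every complex point
`P` of `M_K ⊗_L E` along `τE` and its underlying point `P♭` of `M_K` along `τ`, `ε(P) ≫ pr₁ = f (pts P♭)`.  Here: **any `ε` with that point formula is
INJECTIVE ON COMPLEX POINTS as soon as `f` is** (`RecordSystemGS.algPoints_map_injective_of_sliceDescent`) — the SEPARATION export `sep` of the E-line՚s
PEL witness (LEAD «M-47»: classifying-map provenance; at neat level the chart՚s point map is injective, ★ `UnitaryCurve.eq_of_forall_siegelPointMap_eq`).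
Proof: `P ↦ P♭` is a bijection (★ `Motives.exists_homeomorph_complexPoints_baseChange`, `M_K` proper), `pts` a homeomorphism, and `ε(P)` determines
`f (pts P♭)` through `pr₁`.  HONEST LABEL: HC_CM is proved only modulo the 2 remaining named inputs (hLiu418 24832, h413 24833) until rung 0 closes;
this file is count-neutral.

## References
* [Milne2005ShimuraVarieties] J. S. Milne, *Introduction to Shimura varieties* (2005; rev. 2017), Thm. 13.7 ∕ Rem. 13.8 p. 119, Thm. 5.17 p. 59.
* [RapoportSmithlingZhang2020Diagonal] M. Rapoport, B. Smithling, W. Zhang, *Arithmetic diagonal cycles on unitary Shimura varieties* (2020), §3.2 (3.10).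
-/

set_option autoImplicit false

noncomputable section

open Function MulAction Topology NumberField IsDedekindDomain CategoryTheory CategoryTheory.Limits Matrix
  AlgebraicGeometry
open scoped Matrix ComplexOrder
open Literature.AlgebraicGeometry.Motives Literature.NumberTheory.Automorphic Literature.NumberTheory.Automorphic.UnitaryGroup
open Literature.NumberTheory.Automorphic.Liu2021.AppendixC (C5.OpenCompactSubgroup C5.SmallLevel)
open Literature.AlgebraicGeometry.Motives.AbelianVariety (bcSpec)

namespace Literature.AlgebraicGeometry.ShimuraVarieties.UnitaryCanonicalModel

variable {L : Type} [Field L] [NumberField L] [IsCMField L] {Jstar : Matrix (Fin 2) (Fin 2) L} {τ : L →+* ℂ}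
  {K₀ : C5.OpenCompactSubgroup ↥(finAdelic (↥(maximalRealSubfield L)) L (IsCMField.complexConj L) 2 Jstar)}

/-! ### The slice descent separates complex points when the point map does -/

section Separation

variable (S : RecordSystemGS L Jstar τ K₀) (K : C5.SmallLevel K₀) (M : SchemeOver ℚ)
  (f : ShimuraSetGS L Jstar τ K.1.1 → ComplexPoints M)
  {E : Type} [Field E] [NumberField E] [Algebra L E] (τE : E →+* ℂ)

/-- **The slice descent separates complex points** ([Milne2005ShimuraVarieties] Thm. 13.7 ∕ Rem. 13.8 with the injectivity of the double-coset
map, Thm. 5.17 ∕ (3.10) of [RapoportSmithlingZhang2020Diagonal]): ANY `E`-morphism `ε : M_K ⊗_L E → M ⊗_ℚ E` «inducing `f`» in the sense of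
`exists_sliceDescent_of_complex` (for every complex point `P` along `τE` and its underlying point `P♭` of `M_K` along `τ`, `ε(P) ≫ pr₁ = f (pts P♭)`)
is INJECTIVE on complex points as soon as `f` is injective: `P ↦ P♭` is a bijection (★ `Motives.exists_homeomorph_complexPoints_baseChange`, `M_K`
proper), `pts` is a homeomorphism, and `ε(P)` determines `f (pts P♭)`.  This is the SEPARATION export of the E-line՚s witness at neat level
(where the chart՚s point map is injective, ★ `UnitaryCurve.eq_of_forall_siegelPointMap_eq`). [cite: Milne2005ShimuraVarieties, Thm. 13.7 and Rem. 13.8 p. 119; Thm. 5.17 p. 59]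
[cite: RapoportSmithlingZhang2020Diagonal, §3.2 (3.10) p. 12] -/
theorem RecordSystemGS.algPoints_map_injective_of_sliceDescent (hτ : τE.comp (algebraMap L E) = τ)
    (ε : (Motives.baseChange L E).obj (S.M.obj K) ⟶ (Motives.baseChange ℚ E).obj M)
    (hε : letI : Algebra E ℂ := τE.toAlgebra
      ∀ (P : ComplexPoints ((Motives.baseChange L E).obj (S.M.obj K)))
        (Pflat : letI : Algebra L ℂ := τ.toAlgebra; ComplexPoints (S.M.obj K)),
        Pflat.left = P.left ≫ pullback.fst (S.M.obj K).hom (bcSpec L E) →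
        (AlgPoints.map ε P).left ≫ pullback.fst M.hom (bcSpec ℚ E) =
          (letI : Algebra L ℂ := τ.toAlgebra; (f (S.pts K Pflat)).left))
    (hinj : Function.Injective f) :
    letI : Algebra E ℂ := τE.toAlgebra
    Function.Injective
      (AlgPoints.map ε : ComplexPoints ((Motives.baseChange L E).obj (S.M.obj K)) → ComplexPoints ((Motives.baseChange ℚ E).obj M)) := by
  letI iE : Algebra E ℂ := τE.toAlgebra; letI iL : Algebra L ℂ := τ.toAlgebra
  haveI : IsProper (S.M.obj K).hom := (S.projective K).isProper
  -- the underlying points `P♭` of `M_K` along `τ`, read through the homeomorphism of ★ `exists_homeomorph_complexPoints_baseChange`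
  obtain ⟨e, he, -, -⟩ := Motives.exists_homeomorph_complexPoints_baseChange hτ (S.M.obj K)
  intro P₁ P₂ h
  have h₁ := hε P₁ (e P₁) (he P₁)
  have h₂ := hε P₂ (e P₂) (he P₂)
  -- `ε(P₁) = ε(P₂)` forces `f (pts P₁♭) = f (pts P₂♭)`, hence `P₁♭ = P₂♭`, hence `P₁ = P₂`
  have hf : f (S.pts K (e P₁)) = f (S.pts K (e P₂)) := by
    apply Over.OverMorphism.ext
    rw [← h₁, ← h₂, h]
  exact e.injective ((S.pts K).injective (hinj hf))

end Separation

end Literature.AlgebraicGeometry.ShimuraVarieties.UnitaryCanonicalModel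

end
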